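import Literature.NumberTheory.Transcendental.KZDilationStokesDescent
import HarnessLib

/-!
# Stokes descent for the dilation pencil, IV: dimension two

Specialisation `d = 1` of the Stokes descent (`KZDilationStokesDescent.lean`): for a rational
potential `B = P/Q ∈ ℚ(x₀, x₁)` regular on the open box `(a,b)² ⊇ [0,1]²` (rational `a < 0 < 1 < b`)
and `h = ∂₀B`, the dilation function of the TWO-variable cube integrand `h` is, on all of `[0,1]`,
  `v_h(ϖ) = v_k(ϖ) + (ϖ − 1)·∫₀¹ K(ϖ, ϖy) dy`
with an explicit ONE-variable rational function `k = Kn/Kd ∈ ℚ(x)` regular on `(a,b)`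
(`k(u) = B(1,u) − B(0,u)`) and a kernel `K` Nash on the box (`exists_stokes_repr_dimTwo`). With the
one-variable rational case of the dilation lifting problem (`dilationLiftAtOne_dimOneRational`) and
the twisted-diagonal stub S4 this settles the crux `DilationLiftAtOne` of route
`KontsevichZagierPeriods/LiftingCriteria` for all two-variable `x₀`-exact rational data
`h = ∂₀(P/Q)` — the first two-dimensional sector, and the Stokes sector of "moves lift".

Everything is proved; no `def`, no named fact.

## References
* M. Kontsevich, D. Zagier, *Periods* (2001), §1.2. [`KontsevichZagier2001`]
-/

noncomputable section

open Set MeasureTheory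
open scoped BigOperators Topology
open Literature.ModelTheory.ExponentialFields (IsSemialgebraic)

namespace Literature.NumberTheory.Transcendental

namespace KZ.StokesDescent

/-- From one-variable `MvPolynomial` to `Polynomial`: evaluation is preserved,
`(toUni f)(x) = f(x)` for `toUni = MvPolynomial.aeval (fun _ => X)`. [folklore] -/
theorem aeval_aeval_X (x : ℝ) (f : MvPolynomial (Fin 1) ℚ) :
    Polynomial.aeval x (MvPolynomial.aeval (fun _ : Fin 1 => (Polynomial.X : Polynomial ℚ)) f) =
      MvPolynomial.aeval (fun _ : Fin 1 => x) f := by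
  have h : (Polynomial.aeval x : Polynomial ℚ →ₐ[ℚ] ℝ).comp
      (MvPolynomial.aeval fun _ : Fin 1 => (Polynomial.X : Polynomial ℚ)) =
      MvPolynomial.aeval fun _ : Fin 1 => x :=
    MvPolynomial.algHom_ext fun i => by simp
  exact AlgHom.congr_fun h f

/-- **Stokes descent in dimension two (representation).** For `B = P/Q ∈ ℚ(x₀,x₁)` regular on
`(a,b)²`: one-variable rational data `Kn/Kd` regular on `(a,b)` and a kernel `K` Nash on `(a,b)²`
with `v_{∂₀B}(ϖ) = v_{Kn/Kd}(ϖ) + (ϖ − 1)∫₀¹ K(ϖ, ϖy) dy` for all `ϖ ∈ [0,1]`.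
[cite: KontsevichZagier2001, §1.2] -/
theorem exists_stokes_repr_dimTwo {a b : ℚ} (ha : (a:ℝ) < 0) (hb : 1 < (b:ℝ))
    (P Q : MvPolynomial (Fin 2) ℚ)
    (hQ : ∀ p ∈ Set.pi Set.univ (fun _ : Fin 2 => Ioo (a:ℝ) b), MvPolynomial.aeval p Q ≠ 0) :
    ∃ (Kn Kd : Polynomial ℚ) (K : (Fin 2 → ℝ) → ℝ),
      (∀ x ∈ Ioo (a:ℝ) b, Polynomial.aeval x Kd ≠ 0) ∧
      IsSemialgebraicFunOn ℚ (Set.pi Set.univ (fun _ : Fin 2 => Ioo (a:ℝ) b)) K ∧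
      AnalyticOnNhd ℝ K (Set.pi Set.univ (fun _ : Fin 2 => Ioo (a:ℝ) b)) ∧
      ∀ ϖ ∈ Icc (0:ℝ) 1,
        (∫ z in Set.pi Set.univ (fun _ : Fin 2 => Icc (0:ℝ) 1),
          (MvPolynomial.aeval (ϖ • z) (MvPolynomial.pderiv 0 P) * MvPolynomial.aeval (ϖ • z) Q -
              MvPolynomial.aeval (ϖ • z) P * MvPolynomial.aeval (ϖ • z) (MvPolynomial.pderiv 0 Q)) /
            (MvPolynomial.aeval (ϖ • z) Q) ^ 2) =
          (∫ z in Set.pi Set.univ (fun _ : Fin 1 => Icc (0:ℝ) 1),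
            Polynomial.aeval ((ϖ • z) 0) Kn / Polynomial.aeval ((ϖ • z) 0) Kd) +
          (ϖ - 1) * ∫ y in Set.pi Set.univ (fun _ : Fin 1 => Icc (0:ℝ) 1),
            K (Matrix.vecCons ϖ (ϖ • y)) := by
  obtain ⟨N₁, hN⟩ := exists_stokes_quotient P Q
  -- faces `f(c, ·)` as one-variable polynomials
  set face : ℚ → MvPolynomial (Fin 2) ℚ → MvPolynomial (Fin 1) ℚ := fun c f =>
    MvPolynomial.bind₁ (Fin.cons (MvPolynomial.C c) MvPolynomial.X :
      Fin 2 → MvPolynomial (Fin 1) ℚ) f with hface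
  have hface_eval : ∀ (c : ℚ) (f : MvPolynomial (Fin 2) ℚ) (u : Fin 1 → ℝ),
      MvPolynomial.aeval u (face c f) = MvPolynomial.aeval (Matrix.vecCons (c:ℝ) u) f :=
    fun c f u => aeval_bind₁_cons u f c
  set toUni : MvPolynomial (Fin 1) ℚ → Polynomial ℚ := fun f =>
    MvPolynomial.aeval (fun _ : Fin 1 => (Polynomial.X : Polynomial ℚ)) f with htoUni
  have htoUni_eval : ∀ (f : MvPolynomial (Fin 1) ℚ) (u : Fin 1 → ℝ),
      Polynomial.aeval (u 0) (toUni f) = MvPolynomial.aeval u f := by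
    intro f u
    have hu : (fun _ : Fin 1 => u 0) = u := by
      funext j
      rw [Fin.fin_one_eq_zero j]
    rw [htoUni, aeval_aeval_X, hu]
  -- box membership of faces of one-variable points
  have hmem : ∀ (c : ℝ), c ∈ Ioo (a:ℝ) b → ∀ u : Fin 1 → ℝ, u 0 ∈ Ioo (a:ℝ) b →
      Matrix.vecCons c u ∈ Set.pi Set.univ (fun _ : Fin 2 => Ioo (a:ℝ) b) := by
    intro c hc u hu
    rw [Set.mem_univ_pi]
    refine Fin.cases ?_ (fun j => ?_)
    · simpa using hc
    · rw [Fin.fin_one_eq_zero j]; simpa using hu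
  have h0 : (0:ℝ) ∈ Ioo (a:ℝ) b := ⟨ha, zero_lt_one.trans hb⟩
  have h1 : (1:ℝ) ∈ Ioo (a:ℝ) b := ⟨ha.trans zero_lt_one, hb⟩
  refine ⟨toUni (face 1 P * face 0 Q - face 0 P * face 1 Q), toUni (face 1 Q * face 0 Q),
    fun p => MvPolynomial.aeval p N₁ / (MvPolynomial.aeval p Q *
      MvPolynomial.aeval (Matrix.vecCons 0 (Matrix.vecTail p)) Q *
      MvPolynomial.aeval (Matrix.vecCons 1 (Matrix.vecTail p)) Q), ?_,
    isSemialgebraicFunOn_kernel ha hb Q N₁ hQ, analyticOnNhd_kernel ha hb Q N₁ hQ, ?_⟩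
  · -- the one-variable denominator does not vanish on `(a,b)`
    intro x hx
    have h := htoUni_eval (face 1 Q * face 0 Q) (fun _ => x)
    rw [h, map_mul, hface_eval, hface_eval, Rat.cast_one, Rat.cast_zero]
    exact mul_ne_zero (hQ _ (hmem 1 h1 _ hx)) (hQ _ (hmem 0 h0 _ hx))
  · intro ϖ hϖ
    rw [dilation_integral_pderiv_zero ha hb P Q N₁ hQ hN hϖ]
    congr 1
    refine setIntegral_congr_fun (MeasurableSet.univ_pi fun _ => measurableSet_Icc) fun z hz => ?_
    have hz0 : (ϖ • z) 0 ∈ Icc (0:ℝ) 1 := by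
      have := (Set.mem_univ_pi.mp (smul_mem_cube hϖ hz)) 0
      exact this
    have hzI : (ϖ • z) 0 ∈ Ioo (a:ℝ) b :=
      ⟨lt_of_lt_of_le ha hz0.1, lt_of_le_of_lt hz0.2 hb⟩
    rw [htoUni_eval _ (ϖ • z), htoUni_eval _ (ϖ • z), map_sub, map_mul, map_mul, map_mul,
      hface_eval, hface_eval, hface_eval, hface_eval, Rat.cast_one, Rat.cast_zero]
    have hQ0 : MvPolynomial.aeval (Matrix.vecCons (0:ℝ) (ϖ • z)) Q ≠ 0 := hQ _ (hmem 0 h0 _ hzI)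
    have hQ1 : MvPolynomial.aeval (Matrix.vecCons (1:ℝ) (ϖ • z)) Q ≠ 0 := hQ _ (hmem 1 h1 _ hzI)
    field_simp

end KZ.StokesDescent

end Literature.NumberTheory.Transcendental
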